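import Summits.BirchSwinnertonDyer.BirchSwinnertonDyer.Theorems.AlignedTransportAtTwoMainConjectureTransportAlignedAtTwoOrdPlusLineSelect
import Summits.BirchSwinnertonDyer.BirchSwinnertonDyer.Theorems.AlignedTransportAtTwoMainConjectureTransportAlignedAtTwoOrdPlusLineTools
import Literature.NumberTheory.EllipticCurves.GrossZagierRationalPointPeriodProofs
import HarnessLib

/-!
# Crux C1 `MainConjectureTransportAlignedAtTwo` (stmt-BirchSwinnertonDyer-22296), line `birth`, the `Δ > 0` half (R1) of the promoted residual
# `stub_lamLawResidual`: MINUS-SIDE INTEGRALITY ON `H₁(X₀(L); ℤ)` AND THE Λ-LEVEL SELECTION THEOREM OFF THE KILFORD STRATUM, NO SIGN CONDITION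
# (width seat att-p4 g12; `--supports 22296`)

THEOREMS ONLY (no `def`, no `sorry`, no new named fact). BSD is not proved by this; C1 is not closed by this.

Context (lead att-p1 g9, `Cruxes/…/ORD-PLUSLINE-LANDED-att-p1-g9.md` §4, `Lines/birth-ord-plusline-plan.md`; att-p4 g11
`DELTA-POS-RESIDUAL-att-p4-g11.md` §5). On the Buzzard locus `Δ(W₁) < 0, Δ(W₁) ∉ ℚ₂²` the lead's (K2) pins the mod-`2` plus functional
(`…TwoCurvePlusLine.periodFunctionals_congr_mod_two`) and the `λ`-law follows (`…OrdPlusLine`). For `Δ(W₁) > 0` off the stratum only (K4)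
survives (`…BuzzardKFour.trichotomy_of_dvd_S3`, att-p4 g11): with `f = n̄₁`, `g = m̄₁` (plus / minus functionals of the first depleted form) and
`h = n̄₂`, `h ∈ {0, f, g, f + g}`; the lead's `…OrdPlusLineSelect.eq_of_trichotomy_of_witnesses` then selects `h = f` from two parity
witnesses. This file supplies the pieces the lead's NEXT list names («minus-side integrality `(2D/Ω⁻)·im x(g) ∈ ℤ` on `Λ`, an `ι`-invariant odd
plus witness, an anti-invariant odd minus witness») and assembles them AT THE Λ-LEVEL:

* §1 `im_cuspSymbol_iotaConj` (`im {∞,(ιγι)∞}_g = −im {∞,γ∞}_g` for real `g`); **`exists_int_depleted_minusFunctional`** — for the `S`-depleted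
  form `g` of the newform `f` of `W` at a level `L ⊇ N∏ℓ²`, `D = ∏ℓ²`: `(2D/Ω⁻_f)·im x(g) ∈ ℤ` on `periodHomology L` (`D·{∞,γ∞}_g ∈ Λ_f`,
  `im Λ_f = ℤ·Ω⁻_f/2`); `exists_parityHom` (an integer-valued additive functional on `Λ` reduces to `Λ →+ ℤ/2`).
* §2 **`periodFunctionals_congr_mod_two_of_witnesses`** — the SIGN-FREE twin of the lead's `periodFunctionals_congr_mod_two`: same data WITHOUT
  `Δ(W₁) < 0`, plus a third integral functional `m₁ = c₃·im(·)(g₁)` and two witnesses, (I) `y ∈ Λ` with `n₂(y)` odd and `m₁(y)` even, (II) `z ∈ Λ`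
  with `n₁(z), n₂(z)` even and `m₁(z)` odd; conclusion `n₁ ≡ n₂ (mod 2)` on `Λ` (same output shape, so `…OrdPlusLine` §6–§8 run unchanged —
  see the companion file `…OrdPlusLineWitnessLaw`). **`periodFunctionals_congr_mod_two_of_real_witnesses`** — the geometric form: (I) a
  `γ ∈ Γ₀(N')` whose class is `ι`-INVARIANT (`{∞,(ιγι)∞} = {∞,γ∞}` in `Λ`) with `n₂(γ)` odd, (II) a `γ` whose class is `ι`-ANTI-INVARIANT with
  `m₁(γ)` odd (minus functionals vanish on invariant classes, plus functionals on anti-invariant ones, over `ℤ`).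

HONEST CAVEAT (for the planners). (I)/(II) are SUFFICIENT, not necessary: if the pair sits in cross position (`n̄₂ = m̄₁`) both witnesses are
forced to fail, in sum position (`n̄₂ = n̄₁ + m̄₁`) witness (II) is; so they are facts about the level-`N'` real structure that already know the
answer, not consequences of hypotheses on one curve — the Galois-equivariant pinning (M1)+(M2) of `DELTA-POS-RESIDUAL-att-p4-g11.md` §3 remains
the mechanism. Nothing here touches the Kilford stratum.

References: Buzzard 2000 Prop. 2.4 [Buzzard2000LevelLoweringModTwo]; Darmon–Diamond–Taylor 1995 §1.6, §4.5 [DarmonDiamondTaylor1995];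
Cremona 1997 §2.1, §2.8, §2.10 [CremonaAlgorithms1997]; Manin 1972 §1.6 [Manin1972]; Greenberg–Vatsal 2000 §3 Rem. 3.4 [GreenbergVatsal2000].
-/

noncomputable section

-- justification: the `Summit.BirchSwinnertonDyer.BirchSwinnertonDyer.…` path repeats a component (route-file convention)
set_option linter.dupNamespace false
set_option autoImplicit false

open scoped MatrixGroups ComplexConjugate ModularForm NumberField Classical
open CongruenceSubgroup Complex WeierstrassCurve IsDedekindDomain
open Literature.NumberTheory.EllipticCurves Literature.NumberTheory.EllipticCurves.ModularForms
open Literature.NumberTheory.EllipticCurves.Greenberg1999 Rat.HeightOneSpectrum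
open Summit.BirchSwinnertonDyer.BirchSwinnertonDyer.Theorems.ThetaLayerLambdaCongruenceAtTwo
open Summit.BirchSwinnertonDyer.BirchSwinnertonDyer.Theorems.AlignedTransportAtTwoBuzzardKFour
open Summit.BirchSwinnertonDyer.BirchSwinnertonDyer.Theorems.AlignedTransportAtTwoOrdPlusLineSelect
open Summit.BirchSwinnertonDyer.BirchSwinnertonDyer.Theorems.MazurTateCongruenceAtTwoR.DepletedLattice

namespace Summit.BirchSwinnertonDyer.BirchSwinnertonDyer.Theorems.AlignedTransportAtTwoOrdPlusLineWitness

/-! ## §1 Tools: imaginary parts under cusp negation, minus-side integrality, parity homomorphisms -/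

section Tools

variable {N' : ℕ} [NeZero N']

/-- **`im {∞, (ιγι)∞}_g = −im {∞, γ∞}_g` for a cusp form with real coefficients** (`{∞,(ιγι)∞}_g = conj {∞,γ∞}_g`,
`cuspSymbol_iotaConj`). [cite: Manin1972, §1.6] [cite: CremonaAlgorithms1997, §2.1.4 and §2.8] -/
theorem im_cuspSymbol_iotaConj (g : CuspForm (Gamma0 N') 2) (hreal : ∀ n, (cuspCoeff g n).im = 0) (γ : Gamma0 N') :
    (cuspSymbol g ⟨iotaConj (γ : SL(2, ℤ)), iotaConj_coe_mem_gamma0 γ⟩).im = -(cuspSymbol g γ).im := by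
  rw [cuspSymbol_iotaConj g hreal γ, Complex.conj_im]

/-- **An integer-valued additive real functional on a subgroup reduces to a homomorphism to `ℤ/2`.** For `φ : M → ℝ` additive and
integer-valued on `Λ ≤ M` there is `F : Λ →+ ℤ/2` with `F x = z mod 2` whenever `φ x = z ∈ ℤ`. [folklore] -/
theorem exists_parityHom {M : Type*} [AddCommGroup M] (Λ : AddSubgroup M) (φ : M → ℝ) (hadd : ∀ x y, φ (x + y) = φ x + φ y)
    (hint : ∀ x ∈ Λ, ∃ z : ℤ, φ x = z) :
    ∃ F : Λ →+ ZMod 2, ∀ (x : M) (hx : x ∈ Λ) (z : ℤ), φ x = z → F ⟨x, hx⟩ = (z : ZMod 2) := by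
  have huniq : ∀ {x : M} {z z' : ℤ}, φ x = z → φ x = z' → z = z' := by
    intro x z z' h h'
    exact_mod_cast h.symm.trans h'
  refine ⟨AddMonoidHom.mk' (fun x : Λ ↦ ((hint x.1 x.2).choose : ZMod 2)) ?_, ?_⟩
  · intro x y
    have hx := (hint x.1 x.2).choose_spec
    have hy := (hint y.1 y.2).choose_spec
    have hxy := (hint (x + y).1 (x + y).2).choose_spec
    have e : (hint (x + y).1 (x + y).2).choose = (hint x.1 x.2).choose + (hint y.1 y.2).choose :=
      huniq hxy (by rw [AddSubgroup.coe_add, hadd]; push_cast; linarith)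
    change (((hint (x + y).1 (x + y).2).choose : ℤ) : ZMod 2) =
      (((hint x.1 x.2).choose : ℤ) : ZMod 2) + (((hint y.1 y.2).choose : ℤ) : ZMod 2)
    rw [e, Int.cast_add]
  · intro x hx z hz
    change (((hint x hx).choose : ℤ) : ZMod 2) = _
    rw [huniq (hint x hx).choose_spec hz]

/-- In `ℤ/2`: the class of `z ∈ ℤ` vanishes iff `z` is even. [folklore] -/
theorem intCast_zmod_two_eq_zero_iff_even (z : ℤ) : (z : ZMod 2) = 0 ↔ Even z := by
  rw [ZMod.intCast_zmod_eq_zero_iff_dvd, even_iff_two_dvd]; norm_cast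

end Tools

section Integrality

variable {N : ℕ} [NeZero N] {f : CuspForm (Gamma0 N) 2} (W : WeierstrassCurve ℚ)

/-- **MINUS-SIDE INTEGRALITY: `(2D/Ω⁻_f) · im x(g) ∈ ℤ` on the period homology**, `D = ∏_{ℓ∈S} ℓ²`, for the `S`-depleted form `g` of the
newform `f` of `W` at any level `L` with `N∏ℓ² ∣ L` (twin of `…OrdPlusLineTools.exists_int_depleted_periodFunctional`): on generators
`D·{∞,γ∞}_g ∈ Λ_f` (`DepletedLattice.mul_cuspSymbol_depleted_mem`) and `im Λ_f = ℤ·Ω⁻_f/2` (`imagPeriods_eq_zmultiples_of_minusPeriod_pos`, `Ω⁻_f > 0`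
for a rational newform); closure under `0, +, −`. This is the functional `m = (2D/Ω⁻)·im(·)(g)` of the lead's selection plan.
[cite: CremonaAlgorithms1997, §2.8 (p. 26)] [cite: AtkinLehner1970, §3] -/
theorem exists_int_depleted_minusFunctional [W.IsElliptic] [W.IsGloballyMinimal] (hf : IsNewformOf W f)
    (S : Finset ℕ) (hS : ∀ ℓ ∈ S, ℓ.Prime) (L : ℕ) [NeZero L] (hNL : N * ∏ ℓ ∈ S, ℓ ^ 2 ∣ L)
    (g : CuspForm (Gamma0 L) 2) (hg : ∀ n : ℕ, cuspCoeff g n = if ∃ ℓ ∈ S, ℓ ∣ n then 0 else cuspCoeff f n) :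
    ∀ x ∈ periodHomology L, ∃ z : ℤ, (2 * ((∏ ℓ ∈ S, ℓ ^ 2 : ℕ) : ℝ) / minusPeriod f) * (x g).im = z := by
  have hint : ∀ n : ℕ, ∃ z : ℤ, cuspCoeff f n = z := fun n ↦ ⟨W.LFunction n, hf.2 n⟩
  have hTf : ∀ (p : ℕ) (hp : p.Prime), (haveI : NeZero p := ⟨hp.ne_zero⟩; heckeT (Gamma0 N) 2 p f) = cuspCoeff f p • f :=
    fun p hp ↦ by haveI : NeZero p := ⟨hp.ne_zero⟩; exact hf.1.heckeT_eq_coeff_smul hp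
  have hΩ : 0 < minusPeriod f := IsNewform0.minusPeriod_pos_holds hf.1 hf.coeffField_eq_bot
  have him := imagPeriods_eq_zmultiples_of_minusPeriod_pos (f := f) hΩ
  intro x hx
  refine AddSubgroup.closure_induction (p := fun x _ ↦ ∃ z : ℤ, (2 * ((∏ ℓ ∈ S, ℓ ^ 2 : ℕ) : ℝ) / minusPeriod f) * (x g).im = z)
    ?_ ?_ ?_ ?_ hx
  · rintro _ ⟨γ, rfl⟩
    have hmem := mul_cuspSymbol_depleted_mem f hint hTf S hS L hNL g hg γ
    have himag : (((∏ ℓ ∈ S, ℓ ^ 2 : ℕ) : ℂ) * cuspSymbol g γ).im ∈ imagPeriods f := AddSubgroup.mem_map_of_mem _ hmem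
    rw [him, AddSubgroup.mem_zmultiples_iff] at himag
    obtain ⟨k, hk⟩ := himag
    refine ⟨k, ?_⟩
    rw [periodFunctional_apply]
    have e : (((∏ ℓ ∈ S, ℓ ^ 2 : ℕ) : ℂ) * cuspSymbol g γ).im = ((∏ ℓ ∈ S, ℓ ^ 2 : ℕ) : ℝ) * (cuspSymbol g γ).im := by
      rw [← Complex.ofReal_natCast, Complex.im_ofReal_mul]
    rw [e, zsmul_eq_mul] at hk
    rw [div_mul_eq_mul_div, div_eq_iff hΩ.ne']
    linear_combination (-2 : ℝ) * hk
  · exact ⟨0, by simp⟩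
  · rintro x y _ _ ⟨zx, hzx⟩ ⟨zy, hzy⟩
    exact ⟨zx + zy, by rw [LinearMap.add_apply, Complex.add_im, mul_add, hzx, hzy]; push_cast; ring⟩
  · rintro x _ ⟨zx, hzx⟩
    exact ⟨-zx, by rw [LinearMap.neg_apply, Complex.neg_im, mul_neg, hzx]; push_cast; ring⟩

end Integrality

/-! ## §2 The Λ-level selection theorem (sign-free off the Kilford stratum) -/

section Congruence

variable (W₁ : WeierstrassCurve ℚ) [W₁.IsElliptic] [W₁.IsGloballyMinimal]

/-- **SELECTION OFF THE KILFORD STRATUM, NO SIGN CONDITION.** Data: a globally minimal `S₃`-curve `W₁` with `Δ(W₁) ∉ ℚ₂²` (no `Δ < 0`!), its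
newform `f`, a finite set of primes `S`, an odd level `N'` with `N∏ℓ² ∣ N'`, `primes(N') ⊆ S`, good reduction off `2N'`; the PRINT inputs
`heckeSelfDual_torsionBy_J0`, `buzzard2000_multiplicityOne_gamma0`; two real forms `g₁ g₂ ∈ S₂(Γ₀(N'))`, exact `T_q`-eigen (`q ∤ N'`) with
integer eigenvalues `a_q(W₁)` resp. `a₂(q) ≡ a_q(W₁) (mod 2)`, killed by `T_ℓ` (`ℓ ∣ N'`); three real normalisations `c₁ c₂ c₃` making
`n₁ = c₁·re(·)(g₁)`, `n₂ = c₂·re(·)(g₂)` and the MINUS functional `m₁ = c₃·im(·)(g₁)` integer-valued on `Λ = periodHomology N'`; `n₁` odd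
somewhere; and the two PARITY WITNESSES (I) `y ∈ Λ` with `n₂(y)` odd, `m₁(y)` even, (II) `z ∈ Λ` with `n₁(z), n₂(z)` even, `m₁(z)` odd.
CONCLUSION: `n₁(x) ≡ n₂(x) (mod 2)` for every `x ∈ Λ`. MECHANISM: `K = {n₁, n₂, m₁ all even} ⊇ 2Λ, (T_q^∨ − a_q(W₁))Λ, U_ℓ^∨Λ`; (K4)
`…BuzzardKFour.trichotomy_of_dvd_S3` with `f = n̄₁`, `g = m̄₁`, `h = n̄₂` (`f ≠ 0` by the odd value, `g ≠ 0` and `f ≠ g` by (II)) gives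
`h ∈ {0, f, g, f+g}`, and `…OrdPlusLineSelect.eq_of_trichotomy_of_witnesses` selects `h = f`.
[cite: Buzzard2000LevelLoweringModTwo, Prop. 2.4] [cite: DarmonDiamondTaylor1995, §1.6 Lemma 1.38 and §4.5 Thm. 4.26]
[cite: GreenbergVatsal2000, §3 Remark 3.4] -/
theorem periodFunctionals_congr_mod_two_of_witnesses
    (hSD : heckeSelfDual_torsionBy_J0) (hBz : buzzard2000_multiplicityOne_gamma0)
    (ht : ∀ x : ℚ, ¬ HasRationalTwoTorsionX W₁ x) (hΔ₂ : ∀ s : ℚ_[2], s ^ 2 ≠ (W₁.Δ : ℚ_[2]))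
    {N : ℕ} [NeZero N] {f : CuspForm (Gamma0 N) 2} (hf : IsNewformOf W₁ f)
    (S : Finset ℕ) (hS : ∀ ℓ ∈ S, ℓ.Prime)
    (N' : ℕ) [NeZero N'] (hN' : Odd N') (hNL : N * ∏ ℓ ∈ S, ℓ ^ 2 ∣ N') (hLS : ∀ p : ℕ, p.Prime → p ∣ N' → p ∈ S)
    (hgood : ∀ v : HeightOneSpectrum (𝓞 ℚ), ¬ ((primesEquiv v : ℕ) ∣ 2 * N') → W₁.HasGoodReductionAt v)
    (g₁ g₂ : CuspForm (Gamma0 N') 2) (a₂ : ℕ → ℤ)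
    (hT₁ : ∀ (q : ℕ) (hq : q.Prime), ¬ q ∣ N' →
      (haveI : NeZero q := ⟨hq.ne_zero⟩; heckeT (Gamma0 N') 2 q g₁) = ((W₁.LFunction q : ℤ) : ℂ) • g₁)
    (hT₂ : ∀ (q : ℕ) (hq : q.Prime), ¬ q ∣ N' →
      (haveI : NeZero q := ⟨hq.ne_zero⟩; heckeT (Gamma0 N') 2 q g₂) = ((a₂ q : ℤ) : ℂ) • g₂)
    (hcong : ∀ (q : ℕ), q.Prime → ¬ q ∣ N' → Even (a₂ q - W₁.LFunction q))
    (hU₁ : ∀ (q : ℕ) (hq : q.Prime), q ∣ N' → (haveI : NeZero q := ⟨hq.ne_zero⟩; heckeT (Gamma0 N') 2 q g₁) = 0)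
    (hU₂ : ∀ (q : ℕ) (hq : q.Prime), q ∣ N' → (haveI : NeZero q := ⟨hq.ne_zero⟩; heckeT (Gamma0 N') 2 q g₂) = 0)
    (c₁ c₂ c₃ : ℝ)
    (hint₁ : ∀ x ∈ periodHomology N', ∃ z : ℤ, c₁ * (x g₁).re = z)
    (hint₂ : ∀ x ∈ periodHomology N', ∃ z : ℤ, c₂ * (x g₂).re = z)
    (hint₃ : ∀ x ∈ periodHomology N', ∃ z : ℤ, c₃ * (x g₁).im = z)
    (hodd₁ : ∃ x ∈ periodHomology N', ∃ z : ℤ, c₁ * (x g₁).re = z ∧ Odd z)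
    (hI : ∃ y ∈ periodHomology N', ∃ u v : ℤ, c₂ * (y g₂).re = u ∧ Odd u ∧ c₃ * (y g₁).im = v ∧ Even v)
    (hII : ∃ z ∈ periodHomology N', ∃ u v w : ℤ,
      c₁ * (z g₁).re = u ∧ Even u ∧ c₂ * (z g₂).re = v ∧ Even v ∧ c₃ * (z g₁).im = w ∧ Odd w)
    {x : Module.Dual ℂ (CuspForm (Gamma0 N') 2)} (hx : x ∈ periodHomology N')
    {z₁ z₂ : ℤ} (hz₁ : c₁ * (x g₁).re = z₁) (hz₂ : c₂ * (x g₂).re = z₂) : (Even z₁ ↔ Even z₂) := by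
  classical
  -- uniqueness of the integer value
  have huniq : ∀ {r : ℝ} {z z' : ℤ}, r = z → r = z' → z = z' := by
    intro r z z' h h'
    exact_mod_cast h.symm.trans h'
  -- the subgroup `K = {x : n₁, n₂, m₁ all even}`
  let K : AddSubgroup (Module.Dual ℂ (CuspForm (Gamma0 N') 2)) :=
    { carrier := {y | ∃ w₁ w₂ w₃ : ℤ, c₁ * (y g₁).re = 2 * w₁ ∧ c₂ * (y g₂).re = 2 * w₂ ∧ c₃ * (y g₁).im = 2 * w₃}
      zero_mem' := ⟨0, 0, 0, by simp, by simp, by simp⟩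
      add_mem' := by
        rintro y y' ⟨w₁, w₂, w₃, h₁, h₂, h₃⟩ ⟨w₁', w₂', w₃', h₁', h₂', h₃'⟩
        refine ⟨w₁ + w₁', w₂ + w₂', w₃ + w₃', ?_, ?_, ?_⟩
        · rw [LinearMap.add_apply, Complex.add_re, mul_add, h₁, h₁']; push_cast; ring
        · rw [LinearMap.add_apply, Complex.add_re, mul_add, h₂, h₂']; push_cast; ring
        · rw [LinearMap.add_apply, Complex.add_im, mul_add, h₃, h₃']; push_cast; ring
      neg_mem' := by
        rintro y ⟨w₁, w₂, w₃, h₁, h₂, h₃⟩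
        refine ⟨-w₁, -w₂, -w₃, ?_, ?_, ?_⟩
        · rw [LinearMap.neg_apply, Complex.neg_re, mul_neg, h₁]; push_cast; ring
        · rw [LinearMap.neg_apply, Complex.neg_re, mul_neg, h₂]; push_cast; ring
        · rw [LinearMap.neg_apply, Complex.neg_im, mul_neg, h₃]; push_cast; ring }
  have hKmem : ∀ {y : Module.Dual ℂ (CuspForm (Gamma0 N') 2)},
      y ∈ K ↔ ∃ w₁ w₂ w₃ : ℤ, c₁ * (y g₁).re = 2 * w₁ ∧ c₂ * (y g₂).re = 2 * w₂ ∧ c₃ * (y g₁).im = 2 * w₃ := Iff.rfl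
  -- membership in terms of parities of the three integer values
  have hKiff : ∀ {y : Module.Dual ℂ (CuspForm (Gamma0 N') 2)} {u₁ u₂ u₃ : ℤ}, c₁ * (y g₁).re = u₁ → c₂ * (y g₂).re = u₂ →
      c₃ * (y g₁).im = u₃ → (y ∈ K ↔ Even u₁ ∧ Even u₂ ∧ Even u₃) := by
    intro y u₁ u₂ u₃ hu₁ hu₂ hu₃
    rw [hKmem]
    constructor
    · rintro ⟨w₁, w₂, w₃, h₁, h₂, h₃⟩
      have e₁ : u₁ = 2 * w₁ := huniq hu₁ (by rw [h₁]; push_cast; ring)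
      have e₂ : u₂ = 2 * w₂ := huniq hu₂ (by rw [h₂]; push_cast; ring)
      have e₃ : u₃ = 2 * w₃ := huniq hu₃ (by rw [h₃]; push_cast; ring)
      exact ⟨⟨w₁, by rw [e₁]; ring⟩, ⟨w₂, by rw [e₂]; ring⟩, ⟨w₃, by rw [e₃]; ring⟩⟩
    · rintro ⟨⟨w₁, hw₁⟩, ⟨w₂, hw₂⟩, ⟨w₃, hw₃⟩⟩
      refine ⟨w₁, w₂, w₃, ?_, ?_, ?_⟩
      · rw [hu₁, hw₁]; push_cast; ring
      · rw [hu₂, hw₂]; push_cast; ring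
      · rw [hu₃, hw₃]; push_cast; ring
  -- `2Λ ⊆ K`
  have h2K : ∀ u ∈ periodHomology N', (2 : ℂ) • u ∈ K := by
    intro u hu
    obtain ⟨v₁, hv₁⟩ := hint₁ u hu
    obtain ⟨v₂, hv₂⟩ := hint₂ u hu
    obtain ⟨v₃, hv₃⟩ := hint₃ u hu
    refine ⟨v₁, v₂, v₃, ?_, ?_, ?_⟩
    · rw [LinearMap.smul_apply, smul_eq_mul, show ((2 : ℂ) * u g₁).re = 2 * (u g₁).re by simp [Complex.mul_re], ← mul_assoc,
        mul_comm c₁, mul_assoc, hv₁]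
    · rw [LinearMap.smul_apply, smul_eq_mul, show ((2 : ℂ) * u g₂).re = 2 * (u g₂).re by simp [Complex.mul_re], ← mul_assoc,
        mul_comm c₂, mul_assoc, hv₂]
    · rw [LinearMap.smul_apply, smul_eq_mul, show ((2 : ℂ) * u g₁).im = 2 * (u g₁).im by simp [Complex.mul_im], ← mul_assoc,
        mul_comm c₃, mul_assoc, hv₃]
  -- `(T_q^∨ − a_q(W₁))Λ ⊆ K`
  have hTK : ∀ (q : ℕ) (hq : q.Prime), ¬ q ∣ N' → ∀ u ∈ periodHomology N',
      (haveI : NeZero q := ⟨hq.ne_zero⟩; heckeT (Gamma0 N') 2 q).dualMap u - (W₁.LFunction q : ℂ) • u ∈ K := by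
    intro q hq hqN u hu
    haveI : NeZero q := ⟨hq.ne_zero⟩
    obtain ⟨v₂, hv₂⟩ := hint₂ u hu
    obtain ⟨k, hk⟩ := hcong q hq hqN
    have e₁ : ((heckeT (Gamma0 N') 2 q).dualMap u - (W₁.LFunction q : ℂ) • u) g₁ = 0 := by
      simp only [LinearMap.sub_apply, LinearMap.dualMap_apply, hT₁ q hq hqN, map_smul, LinearMap.smul_apply, smul_eq_mul]
      rw [sub_self]
    refine ⟨0, k * v₂, 0, ?_, ?_, ?_⟩
    · rw [e₁, Complex.zero_re, mul_zero]; push_cast; ring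
    · have e : ((heckeT (Gamma0 N') 2 q).dualMap u - (W₁.LFunction q : ℂ) • u) g₂ = ((a₂ q - W₁.LFunction q : ℤ) : ℂ) * u g₂ := by
        simp only [LinearMap.sub_apply, LinearMap.dualMap_apply, hT₂ q hq hqN, map_smul, LinearMap.smul_apply, smul_eq_mul]
        push_cast; ring
      rw [e, show ((((a₂ q - W₁.LFunction q : ℤ)) : ℂ) * u g₂).re = (a₂ q - W₁.LFunction q : ℤ) * (u g₂).re by
        simp [Complex.mul_re], hk, ← mul_assoc, mul_comm c₂, mul_assoc, hv₂]
      push_cast; ring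
    · rw [e₁, Complex.zero_im, mul_zero]; push_cast; ring
  -- `U_ℓ^∨Λ ⊆ K`
  have hUK : ∀ (q : ℕ) (hq : q.Prime), q ∣ N' → ∀ u ∈ periodHomology N',
      (haveI : NeZero q := ⟨hq.ne_zero⟩; heckeT (Gamma0 N') 2 q).dualMap u ∈ K := by
    intro q hq hqN u _
    haveI : NeZero q := ⟨hq.ne_zero⟩
    refine ⟨0, 0, 0, ?_, ?_, ?_⟩
    · rw [LinearMap.dualMap_apply, hU₁ q hq hqN, map_zero, Complex.zero_re, mul_zero]; push_cast; ring
    · rw [LinearMap.dualMap_apply, hU₂ q hq hqN, map_zero, Complex.zero_re, mul_zero]; push_cast; ring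
    · rw [LinearMap.dualMap_apply, hU₁ q hq hqN, map_zero, Complex.zero_im, mul_zero]; push_cast; ring
  -- the three mod-2 functionals `F₁ = n̄₁`, `F₂ = n̄₂`, `F₃ = m̄₁` on `Λ`
  obtain ⟨F₁, hF₁⟩ := exists_parityHom (periodHomology N') (fun y ↦ c₁ * (y g₁).re)
    (fun y y' ↦ by rw [LinearMap.add_apply, Complex.add_re, mul_add]) hint₁
  obtain ⟨F₂, hF₂⟩ := exists_parityHom (periodHomology N') (fun y ↦ c₂ * (y g₂).re)
    (fun y y' ↦ by rw [LinearMap.add_apply, Complex.add_re, mul_add]) hint₂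
  obtain ⟨F₃, hF₃⟩ := exists_parityHom (periodHomology N') (fun y ↦ c₃ * (y g₁).im)
    (fun y y' ↦ by rw [LinearMap.add_apply, Complex.add_im, mul_add]) hint₃
  -- they kill `K ∩ Λ`
  have hkill : ∀ y : periodHomology N', (y : Module.Dual ℂ (CuspForm (Gamma0 N') 2)) ∈ K → F₁ y = 0 ∧ F₂ y = 0 ∧ F₃ y = 0 := by
    intro y hy
    obtain ⟨u₁, hu₁⟩ := hint₁ y y.2
    obtain ⟨u₂, hu₂⟩ := hint₂ y y.2
    obtain ⟨u₃, hu₃⟩ := hint₃ y y.2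
    obtain ⟨he₁, he₂, he₃⟩ := (hKiff hu₁ hu₂ hu₃).mp hy
    exact ⟨(hF₁ y y.2 u₁ hu₁).trans ((intCast_zmod_two_eq_zero_iff_even u₁).mpr he₁),
      (hF₂ y y.2 u₂ hu₂).trans ((intCast_zmod_two_eq_zero_iff_even u₂).mpr he₂),
      (hF₃ y y.2 u₃ hu₃).trans ((intCast_zmod_two_eq_zero_iff_even u₃).mpr he₃)⟩
  -- the witnesses, read as values of `F₁, F₂, F₃`
  obtain ⟨y, hy, uy, vy, huy, huyodd, hvy, hvyev⟩ := hI
  obtain ⟨z, hz, uz, vz, wz, huz, huzev, hvz, hvzev, hwz, hwzodd⟩ := hII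
  obtain ⟨x₁, hx₁, u₁, hu₁, hu₁odd⟩ := hodd₁
  have hF₂y : F₂ ⟨y, hy⟩ ≠ 0 := fun h ↦ (Int.not_even_iff_odd.mpr huyodd)
    ((intCast_zmod_two_eq_zero_iff_even uy).mp ((hF₂ y hy uy huy).symm.trans h))
  have hF₃y : F₃ ⟨y, hy⟩ = 0 := (hF₃ y hy vy hvy).trans ((intCast_zmod_two_eq_zero_iff_even vy).mpr hvyev)
  have hF₁z : F₁ ⟨z, hz⟩ = 0 := (hF₁ z hz uz huz).trans ((intCast_zmod_two_eq_zero_iff_even uz).mpr huzev)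
  have hF₂z : F₂ ⟨z, hz⟩ = 0 := (hF₂ z hz vz hvz).trans ((intCast_zmod_two_eq_zero_iff_even vz).mpr hvzev)
  have hF₃z : F₃ ⟨z, hz⟩ ≠ 0 := fun h ↦ (Int.not_even_iff_odd.mpr hwzodd)
    ((intCast_zmod_two_eq_zero_iff_even wz).mp ((hF₃ z hz wz hwz).symm.trans h))
  have hF₁x₁ : F₁ ⟨x₁, hx₁⟩ ≠ 0 := fun h ↦ (Int.not_even_iff_odd.mpr hu₁odd)
    ((intCast_zmod_two_eq_zero_iff_even u₁).mp ((hF₁ x₁ hx₁ u₁ hu₁).symm.trans h))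
  have hF₁0 : F₁ ≠ 0 := fun h ↦ hF₁x₁ (by rw [h, AddMonoidHom.zero_apply])
  have hF₃0 : F₃ ≠ 0 := fun h ↦ hF₃z (by rw [h, AddMonoidHom.zero_apply])
  have hF₁₃ : F₁ ≠ F₃ := fun h ↦ hF₃z (by rw [← h, hF₁z])
  -- (K4) trichotomy and selection
  have htri : F₂ = 0 ∨ F₂ = F₁ ∨ F₂ = F₃ ∨ F₂ = F₁ + F₃ :=
    trichotomy_of_dvd_S3 hSD hBz W₁ ht hΔ₂ hf S hS N' hN' hNL hLS hgood K h2K hTK hUK F₁ F₃ F₂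
      (fun y hy ↦ (hkill y hy).1) (fun y hy ↦ (hkill y hy).2.2) (fun y hy ↦ (hkill y hy).2.1) hF₁0 hF₃0 hF₁₃
  have hsel : F₂ = F₁ := eq_of_trichotomy_of_witnesses htri hF₂y hF₃y hF₂z hF₁z hF₃z
  -- read off at `x`
  have e₁ := hF₁ x hx z₁ hz₁
  have e₂ := hF₂ x hx z₂ hz₂
  rw [hsel, e₁] at e₂
  rw [← intCast_zmod_two_eq_zero_iff_even z₁, ← intCast_zmod_two_eq_zero_iff_even z₂, e₂]

/-- **THE GEOMETRIC FORM: (anti-)invariant classes of the real structure.** In the setting of `periodFunctionals_congr_mod_two_of_witnesses`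
with `g₁, g₂` REAL, the parity witnesses are supplied by (I) a `γ ∈ Γ₀(N')` whose homology class is INVARIANT under the cusp negation
`ι : γ ↦ εγε` (`{∞,(εγε)∞} = {∞,γ∞}` in `Λ`) with `n₂(γ) = c₂·re{∞,γ∞}_{g₂}` odd, and (II) a `γ` whose class is ANTI-INVARIANT
(`{∞,(εγε)∞} = −{∞,γ∞}`) with `m₁(γ) = c₃·im{∞,γ∞}_{g₁}` odd: since `{∞,(εγε)∞}_g = conj {∞,γ∞}_g` for real `g`, minus functionals vanish on
invariant classes and plus functionals on anti-invariant ones (over `ℤ`, not only mod `2`). These are the «real ovals of `X₀(N')(ℝ)`» witnesses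
of the lead's plan (classes in `Ĥ⁰(C₂; Λ^±)`; `(1 ± ι)Λ` gives only even values, `…OrdPlusLineSelect.even_apply_add_of_apply_involution`).
[cite: Manin1972, §1.6] [cite: Buzzard2000LevelLoweringModTwo, Prop. 2.4] [cite: GreenbergVatsal2000, §3 Remark 3.4] -/
theorem periodFunctionals_congr_mod_two_of_real_witnesses
    (hSD : heckeSelfDual_torsionBy_J0) (hBz : buzzard2000_multiplicityOne_gamma0)
    (ht : ∀ x : ℚ, ¬ HasRationalTwoTorsionX W₁ x) (hΔ₂ : ∀ s : ℚ_[2], s ^ 2 ≠ (W₁.Δ : ℚ_[2]))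
    {N : ℕ} [NeZero N] {f : CuspForm (Gamma0 N) 2} (hf : IsNewformOf W₁ f)
    (S : Finset ℕ) (hS : ∀ ℓ ∈ S, ℓ.Prime)
    (N' : ℕ) [NeZero N'] (hN' : Odd N') (hNL : N * ∏ ℓ ∈ S, ℓ ^ 2 ∣ N') (hLS : ∀ p : ℕ, p.Prime → p ∣ N' → p ∈ S)
    (hgood : ∀ v : HeightOneSpectrum (𝓞 ℚ), ¬ ((primesEquiv v : ℕ) ∣ 2 * N') → W₁.HasGoodReductionAt v)
    (g₁ g₂ : CuspForm (Gamma0 N') 2) (hreal₁ : ∀ n, (cuspCoeff g₁ n).im = 0) (hreal₂ : ∀ n, (cuspCoeff g₂ n).im = 0) (a₂ : ℕ → ℤ)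
    (hT₁ : ∀ (q : ℕ) (hq : q.Prime), ¬ q ∣ N' →
      (haveI : NeZero q := ⟨hq.ne_zero⟩; heckeT (Gamma0 N') 2 q g₁) = ((W₁.LFunction q : ℤ) : ℂ) • g₁)
    (hT₂ : ∀ (q : ℕ) (hq : q.Prime), ¬ q ∣ N' →
      (haveI : NeZero q := ⟨hq.ne_zero⟩; heckeT (Gamma0 N') 2 q g₂) = ((a₂ q : ℤ) : ℂ) • g₂)
    (hcong : ∀ (q : ℕ), q.Prime → ¬ q ∣ N' → Even (a₂ q - W₁.LFunction q))
    (hU₁ : ∀ (q : ℕ) (hq : q.Prime), q ∣ N' → (haveI : NeZero q := ⟨hq.ne_zero⟩; heckeT (Gamma0 N') 2 q g₁) = 0)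
    (hU₂ : ∀ (q : ℕ) (hq : q.Prime), q ∣ N' → (haveI : NeZero q := ⟨hq.ne_zero⟩; heckeT (Gamma0 N') 2 q g₂) = 0)
    (c₁ c₂ c₃ : ℝ)
    (hint₁ : ∀ x ∈ periodHomology N', ∃ z : ℤ, c₁ * (x g₁).re = z)
    (hint₂ : ∀ x ∈ periodHomology N', ∃ z : ℤ, c₂ * (x g₂).re = z)
    (hint₃ : ∀ x ∈ periodHomology N', ∃ z : ℤ, c₃ * (x g₁).im = z)
    (hodd₁ : ∃ x ∈ periodHomology N', ∃ z : ℤ, c₁ * (x g₁).re = z ∧ Odd z)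
    (hI : ∃ γ : Gamma0 N', periodFunctional N' ⟨iotaConj (γ : SL(2, ℤ)), iotaConj_coe_mem_gamma0 γ⟩ = periodFunctional N' γ ∧
      ∃ u : ℤ, c₂ * (cuspSymbol g₂ γ).re = u ∧ Odd u)
    (hII : ∃ γ : Gamma0 N', periodFunctional N' ⟨iotaConj (γ : SL(2, ℤ)), iotaConj_coe_mem_gamma0 γ⟩ = -periodFunctional N' γ ∧
      ∃ w : ℤ, c₃ * (cuspSymbol g₁ γ).im = w ∧ Odd w)
    {x : Module.Dual ℂ (CuspForm (Gamma0 N') 2)} (hx : x ∈ periodHomology N')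
    {z₁ z₂ : ℤ} (hz₁ : c₁ * (x g₁).re = z₁) (hz₂ : c₂ * (x g₂).re = z₂) : (Even z₁ ↔ Even z₂) := by
  -- (I): on an invariant class the minus functional vanishes
  obtain ⟨γ, hγ, u, hu, huodd⟩ := hI
  have him₁ : (cuspSymbol g₁ γ).im = 0 := by
    have h := congrArg (fun φ : Module.Dual ℂ (CuspForm (Gamma0 N') 2) ↦ (φ g₁).im) hγ
    simp only [periodFunctional_apply, im_cuspSymbol_iotaConj g₁ hreal₁ γ] at h
    linarith
  have hI' : ∃ y ∈ periodHomology N', ∃ u v : ℤ, c₂ * (y g₂).re = u ∧ Odd u ∧ c₃ * (y g₁).im = v ∧ Even v :=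
    ⟨periodFunctional N' γ, periodFunctional_mem_periodHomology N' γ, u, 0, by rwa [periodFunctional_apply], huodd,
      by rw [periodFunctional_apply, him₁, mul_zero, Int.cast_zero], ⟨0, rfl⟩⟩
  -- (II): on an anti-invariant class the plus functionals vanish
  obtain ⟨δ, hδ, w, hw, hwodd⟩ := hII
  have hre : ∀ (g : CuspForm (Gamma0 N') 2), (∀ n, (cuspCoeff g n).im = 0) → (cuspSymbol g δ).re = 0 := by
    intro g hreal
    have h := congrArg (fun φ : Module.Dual ℂ (CuspForm (Gamma0 N') 2) ↦ (φ g).re) hδ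
    simp only [periodFunctional_apply, LinearMap.neg_apply, Complex.neg_re, cuspSymbol_iotaConj g hreal δ, Complex.conj_re] at h
    linarith
  have hII' : ∃ z ∈ periodHomology N', ∃ u v w : ℤ,
      c₁ * (z g₁).re = u ∧ Even u ∧ c₂ * (z g₂).re = v ∧ Even v ∧ c₃ * (z g₁).im = w ∧ Odd w :=
    ⟨periodFunctional N' δ, periodFunctional_mem_periodHomology N' δ, 0, 0, w,
      by rw [periodFunctional_apply, hre g₁ hreal₁, mul_zero, Int.cast_zero], ⟨0, rfl⟩,
      by rw [periodFunctional_apply, hre g₂ hreal₂, mul_zero, Int.cast_zero], ⟨0, rfl⟩,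
      by rwa [periodFunctional_apply], hwodd⟩
  exact periodFunctionals_congr_mod_two_of_witnesses W₁ hSD hBz ht hΔ₂ hf S hS N' hN' hNL hLS hgood g₁ g₂ a₂ hT₁ hT₂ hcong hU₁ hU₂
    c₁ c₂ c₃ hint₁ hint₂ hint₃ hodd₁ hI' hII' hx hz₁ hz₂

end Congruence

end Summit.BirchSwinnertonDyer.BirchSwinnertonDyer.Theorems.AlignedTransportAtTwoOrdPlusLineWitness

end
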